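import Literature.MathematicalPhysics.QuantumFieldTheory.Balaban1983to89.B9Eq342GradientRowAssembly
import Literature.MathematicalPhysics.QuantumFieldTheory.Balaban1983to89.B9Eq326LocalPartSliceEquation
import Literature.MathematicalPhysics.QuantumFieldTheory.Balaban1983to89.B9Eq38CovDivSliceGradient

/-!
# `Balaban1983to89.B9Eq326LocalPartDivergenceRow` — T. Bałaban, *Propagators for lattice gauge theories in a background field*, Commun. Math. Phys. **99**
# (1985) 389–434 [Balaban1985BackgroundPropagators] (3.26) p. 395 (the local part `A₀ = Δ(U) + D_UD*_U + aQ*Q` of `Δ_a`), (3.8) p. 392, Thm 3.1 (3.42) p. 397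
# (second entry, the covariant-gradient row), (3.23) p. 394, with [Balaban1985Variational] (134)–(135) p. 298: **STOREY J FOR THE LOCAL PART — THE WEIGHTED
# ROW OF `D*_U u` FOR A SOLUTION OF `L_K u + P u = f` (`L_K` the covariant bond Laplacian in Kato form, `P` ANY order-zero part: the OWNER's
# `A₀ = L_K + [Q†(a•Q) + (Δ′ − η⁻²𝒦)]`, `B9Eq326LocalPartKatoForm.localPart_eq_kato_add`).  Composition BY NAME of three tree∕staged pieces of this lineage:
# `B9Eq326LocalPartSliceEquation` (each μ-slice of `u` solves a site equation `(Δ_U + m)u_μ + p_μ = f_μ` with the free comparison mass in the data term),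
# `B9Eq342GradientRowAssembly` §5 (storey J's gradient row of that site equation, the order-zero term being DATA), `B9Eq38CovDivSliceGradient` §3
# (`(D*_U u)(y) = −Σ_μ S·(D_U u_μ)(y − e_μ, μ)` ⟹ the divergence row is the sum of the slice rows, weight read at `y`).  OUTPUT: for every site `y`,
# `‖(D*_U u)(y)‖ ≤ (Σ_μ B_μ)·ρ·W_{x₀}(y)`, `ρ = (|t|(Γ + (N_P + |m|N_u) + ε₂N_u) + (|t|δ∕β)N_u)∕(1 − |t|ε₁)` — the row of plan v11 §2 (ii)'s `D*_UA₀⁻¹` modulo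
# the DISPLAYED weighted rows `Γ` (data), `N_P` (order-zero part: `B9Eq326LocalPartZerothOrderWeightedRow`), `N_u` (value: storey D for `A₀`) and storey J's
# letters (cutoffs, comparison gauges, `δ`, `b`, `b′`, `β`, `hθ`)** — the OWNER's plan v11 §2 (ii) (`t4/b2b-balaban-t4-ne9-p1/g91/PLAN-V11-STOREY-G1.md`)

statement-level skeleton of published theorems with citation tags; proofs where landed; nothing here is a claim about the Yang–Mills mass gap

CITATION HEADER (lean-in-tree rule).  Audit cell `pub-balaban`, sub-cell `t4`, BINDER row NE9; filed by NE9 crux-team LEAF PROVER 05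
(`b2b-balaban-t4-ne9-formalise-leaf-05`, gen 85).  Imports this lineage's `B9Eq342GradientRowAssembly` (g84, (K41)), `B9Eq326LocalPartSliceEquation` (g84,
(K42), tree p390630) and `B9Eq38CovDivSliceGradient` (g85, (K46)).  SOURCE READ first-hand in the held text layer [Balaban1985BackgroundPropagators]
(`paper:balaban1985-cmp99-background-propagators`): p. 395 (3.26); p. 392 (3.8); p. 394 (3.23); p. 397 Thm 3.1 (3.42); [Balaban1985Variational] p. 298
(134)–(135).  Print proves the gradient rows by the random walk of Sect. 3 pp. 398–409; the cell's storey J is a weighted sup-norm contraction (t4-ne9-idea-1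
N17 ∕ N22 ∕ N44–N46; this lineage g77–g85) — [folklore] composition; nothing printed is a hypothesis; the `[cite: …]` tags are TEXT LOCATIONS.

WHAT IS PROVED (sorry-free; 0 `def`; [folklore]).  Setting of `B9Eq342GradientRowAssembly` §3 (lattice `TSite d N`, `N_ν ≥ 2`; `t > 0`, `m > 0`, rate
`0 ≤ a` with `2dt²(cosh a − 1) < m`; centre `x₀`, product-`cosh` weight `W_{x₀}`, direction constants `B_ν`; fibre `V` read in `𝔸` along `φ`; comparison
gauges `g_{b₀}` with `hAd`; transporter data `R, S` with `SR = 1`, contractions; cutoff family `χ_{b₀}` with its letters and supports `Ω_{b₀}`; fibre letters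
`δ, b, b′`; currency `0 < β ≤ B_ν`; contraction binder `hθ`) and a BOND equation `L_K u + P u = f` (`L_K = bondLapK t R S`, `P` any linear map) with weighted
rows on bonds: `‖f(b)‖ ≤ Γ·W(b.1)`, `‖(Pu)(b)‖ ≤ N_P·W(b.1)`, `‖u(b)‖ ≤ N_u·W(b.1)`.
* **`norm_covDerivL2K_slice_le_weighted`** — every μ-slice `u_μ = (WL2.equiv).symm (u(·, μ))` has storey J's gradient row
  `‖(D_U u_μ)(b)‖ ≤ ρ·(B_{b.2}·W(b₊))` at every bond `b` ((K42) `slice_equation` ∕ `norm_slice_data_le` feed (K41) §5 with `Γ`, `N_p := N_P + ‖m‖N_u`, `N_u`).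
* **`norm_covDivL2K_le_weighted`** — `‖(D*_U u)(y)‖ ≤ (Σ_μ ρ·B_μ)·W(y)` at every site `y` ((K46) §3 on the slice rows).
* **`norm_covDivL2K_le_weighted_uniform`** — the t-free closing (`B9Eq342GradientRowAssembly` §4's mass choice ⟹ `θ ≤ 1∕2`): `≤ (Σ_ν 2ρ₀·B_ν)·W(y)`,
  `ρ₀` the numerator of `ρ` — no denominator, no `hθ`.
HONEST SCOPE.  Composition only; the three weighted rows and every storey-J letter stay DISPLAYED; the currency junction from the OWNER's (D0)∕(I0) block-decay
rows of `A₀⁻¹` to the `cosh`-weight rows `Γ`, `N_u` is NOT here; the transposed row `A₀⁻¹D_U` is NOT here; the mass `m` is free (it only enters `N_p` and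
`B_ν`).  Nothing of [B9] Thm 3.1∕3.3∕3.11 is asserted, valued or discharged.  NOT NE9 (cell pub-balaban: NE9 NOT PRINTED ∕ NOT PROVED; «NE9 ⇐ the named
binders»; row WALLED ON A MODEL (O-NE9-1; #5 UNRULED); spine PROVED 0∕9; rung (B)+1 on a finite T⁴ — NOT infinite volume, NOT mass gap, NOT Clay; HONEST
DEPENDENCY: continuum YM on T⁴ ⇐ BetaPertH ∧ nine spine estimates (0/9 proved); BetaPertH ⇐ (D1) ∧ (D4) ∧ CAP+tail; G-an2-4 gates asym, D1 and NE2/3/4).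
NEW file; nothing modified.  Net new unproved facts: 0.
-/

noncomputable section

set_option autoImplicit false

open scoped BigOperators InnerProductSpace

namespace Literature.MathematicalPhysics.QuantumFieldTheory.Balaban1983to89.B9Eq326LocalPartDivergenceRow

open B4Sect5Torus (TSite)
open B9SectCLatticeCarrier (Bond bpos btgt shift unshift)
open B4TorusKernel.MultiPeriod (circAbs)
open B9Eq311L2Pairing (WL2)
open B9Eq310HessianOperator (adTransportW)
open B11Eq103H1Complex (SiteL2K BondL2K covLaplaceSiteK covDerivL2K covDivL2K)
open B9Eq328GaugeAction (gaugeU AdW)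
open B9Eq326LocalPartKatoForm (bondLapK)
open B9Eq326LocalPartSliceEquation (slice_equation norm_slice_data_le)
open B9Eq342GradientRowNaturalPerturbation (weight_site_pos theta_le theta_le_half)
open B9Eq342GradientRowAssembly (norm_covDeriv_le_weighted_of_letters_penalty div_one_sub_le_two_mul)
open B9Eq38CovDivSliceGradient (norm_equiv_covDivL2K_le_weighted_of_slice_rows)

variable {d : ℕ} {N : Fin d → ℕ} [∀ μ, NeZero (N μ)] {𝔸 : Type*} [Ring 𝔸] [Algebra ℂ 𝔸] {V : Type*} [NormedAddCommGroup V] [InnerProductSpace ℂ V]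
  [FiniteDimensional ℂ V] (φ : V ≃ₗ[ℂ] 𝔸) {c₁ : ℝ} [Fact (0 < c₁)] (t m a : ℝ) (hm : 0 < m) (x₀ : TSite d N) (gf : Bond d N → TSite d N → 𝔸ˣ)
  (hAdf : ∀ (b₀ : Bond d N) (x : TSite d N) (v v' : V), ⟪AdW φ (gf b₀ x) v, AdW φ (gf b₀ x) v'⟫_ℂ = ⟪v, v'⟫_ℂ)

/-- (local, syntactic) the product-`cosh` weight at `x₀`, the direction constants, the `b₀`-th pure-gauge transporters — as in `B9Eq342GradientRowAssembly`. -/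
local notation "WT" => (fun y : TSite d N => ∏ μ, Real.cosh (a * (circAbs (N μ) (ZMod.val (((x₀ μ : ℕ) : ZMod (N μ)) - ((y μ : ℕ) : ZMod (N μ)))) : ℝ)))
local notation "BC" => (fun ν : Fin d => (1 + Real.exp (-a)) * ((1 + 2 * t / (N ν * Real.sqrt (m - 2 * ((d : ℝ) - 1) * t ^ 2 * (Real.cosh a - 1)))) /
      Real.sqrt ((m - 2 * ((d : ℝ) - 1) * t ^ 2 * (Real.cosh a - 1)) ^ 2 + 4 * (m - 2 * ((d : ℝ) - 1) * t ^ 2 * (Real.cosh a - 1)) * t ^ 2)) +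
    2 * Real.sinh a / (m - 2 * (d : ℝ) * t ^ 2 * (Real.cosh a - 1)))
local notation "RP[" b₀ "]" => (adTransportW φ (gaugeU (gf b₀) 1) : Bond d N → V →ₗ[ℂ] V)
local notation "SP[" b₀ "]" => (adTransportW φ (fun bb => (gaugeU (gf b₀) 1 bb)⁻¹) : Bond d N → V →ₗ[ℂ] V)

include hAdf hm in
/-- **STOREY J ON A SLICE OF THE LOCAL PART's SOLUTION.**  `L_K u + P u = f` on bonds with weighted rows `Γ` (data), `N_P` (order-zero part), `N_u` (value) on
the site weight `W_{x₀}` ⟹ for every direction `μ` (slice `u_μ = (WL2.equiv).symm (u(·, μ))`) and every bond `b`: `‖(D_U u_μ)(b)‖ ≤ ρ·(B_{b.2}·W_{x₀}(b₊))`,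
`ρ = (|t|((Γ + (N_P + ‖m‖N_u)) + ε₂N_u) + (|t|δ∕β)N_u)∕(1 − |t|ε₁)` — `B9Eq342GradientRowAssembly.norm_covDeriv_le_weighted_of_letters_penalty` at the slice
equation of `B9Eq326LocalPartSliceEquation`. [folklore] [cite: Balaban1985BackgroundPropagators, (3.26) p.395, (3.23) p.394, Thm 3.1 (3.42) p.397] -/
theorem norm_covDerivL2K_slice_le_weighted (ht : 0 < t) (ha : 0 ≤ a) (hlam : 2 * (d : ℝ) * t ^ 2 * (Real.cosh a - 1) < m)
    (hn : ∀ ν, 2 ≤ N ν) (R S : Bond d N → V →ₗ[ℂ] V) (hSR : ∀ b w, S b (R b w) = w) (hRc : ∀ b w, ‖R b w‖ ≤ ‖w‖) (hSc : ∀ b w, ‖S b w‖ ≤ ‖w‖)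
    (P : BondL2K ℂ d N c₁ V →ₗ[ℂ] BondL2K ℂ d N c₁ V) (u f : BondL2K ℂ d N c₁ V) (hu : bondLapK ℂ c₁ (t : ℂ) R S u + P u = f)
    {Γ NP Nu : ℝ} (hΓ : 0 ≤ Γ) (hNP : 0 ≤ NP) (hNu : 0 ≤ Nu) (hf : ∀ b : Bond d N, ‖WL2.equiv ℂ _ V f b‖ ≤ Γ * WT b.1)
    (hPu : ∀ b : Bond d N, ‖WL2.equiv ℂ _ V (P u) b‖ ≤ NP * WT b.1) (hval : ∀ b : Bond d N, ‖WL2.equiv ℂ _ V u b‖ ≤ Nu * WT b.1)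
    (χ : Bond d N → TSite d N → ℝ) (hχ1 : ∀ b₀ y, |χ b₀ y| ≤ 1) (hχp : ∀ b₀, χ b₀ (bpos b₀) = 1) (hχt : ∀ b₀, χ b₀ (btgt b₀) = 1)
    {c r : ℝ} (hcr : 0 ≤ c / r) (hcr2 : 0 ≤ c / r ^ 2) (h1p : ∀ b₀ x μ, |t * (χ b₀ (shift μ x) - χ b₀ x)| ≤ c / r)
    (h1m : ∀ b₀ x μ, |t * (χ b₀ x - χ b₀ (unshift μ x))| ≤ c / r) (h2 : ∀ b₀ x μ, |t ^ 2 * (2 * χ b₀ x - χ b₀ (shift μ x) - χ b₀ (unshift μ x))| ≤ c / r ^ 2)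
    (Ω : Bond d N → Set (TSite d N)) (hΩ : ∀ b₀ x, x ∉ Ω b₀ → χ b₀ x = 0 ∧ (∀ μ, χ b₀ (shift μ x) = 0) ∧ (∀ μ, χ b₀ (unshift μ x) = 0))
    {δ b b' : ℝ} (hδ0 : 0 ≤ δ) (hb : 0 ≤ b) (hb' : 0 ≤ b') (hδ : ∀ b₀ w, ‖R b₀ w - RP[b₀] b₀ w‖ ≤ δ * ‖w‖)
    (hBp : ∀ b₀, ∀ x ∈ Ω b₀, ∀ μ w, ‖RP[b₀] (x, μ) (S (x, μ) w) - w‖ ≤ b * ‖w‖)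
    (hBm : ∀ b₀, ∀ x ∈ Ω b₀, ∀ μ w, ‖RP[b₀] (unshift μ x, μ) (S (unshift μ x, μ) w) - w‖ ≤ b * ‖w‖)
    (hBt : ∀ b₀, ∀ x ∈ Ω b₀, ∀ μ w, ‖SP[b₀] (unshift μ x, μ) w - S (unshift μ x, μ) w‖ ≤ b * ‖w‖)
    (hD : ∀ b₀, ∀ x ∈ Ω b₀, ∀ μ w, ‖(RP[b₀] (x, μ) (S (x, μ) w) - w) -
      SP[b₀] (unshift μ x, μ) (RP[b₀] (unshift μ x, μ) (S (unshift μ x, μ) (RP[b₀] (unshift μ x, μ) w)) - RP[b₀] (unshift μ x, μ) w)‖ ≤ b' * ‖w‖)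
    {β : ℝ} (hβ : 0 < β) (hβB : ∀ ν, β ≤ BC ν)
    (hθ : ‖(t : ℂ)‖ * ((c / r + |t| * b) * ((Real.exp a + 1) * ∑ ν, BC ν)) < 1) (μ : Fin d) (bnd : Bond d N) :
    ‖WL2.equiv ℂ _ V (covDerivL2K ℂ c₁ (t : ℂ) R
        ((WL2.equiv ℂ (fun _ : TSite d N => c₁) V).symm fun y => WL2.equiv ℂ (fun _ : Bond d N => c₁) V u (y, μ))) bnd‖ ≤
      (‖(t : ℂ)‖ * ((Γ + (NP + ‖((m : ℝ) : ℂ)‖ * Nu)) +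
          ((d : ℝ) * (c / r ^ 2) + |t| * b * (c / r) * ((d : ℝ) * (1 + Real.exp a)) + (d : ℝ) * (t ^ 2 * (b' + b * b))) * Nu) + |t| * δ / β * Nu) /
        (1 - ‖(t : ℂ)‖ * ((c / r + |t| * b) * ((Real.exp a + 1) * ∑ ν, BC ν))) * (BC bnd.2 * WT (btgt bnd)) := by
  -- the slice equation with the free comparison mass `m` in the data term
  have hs := slice_equation (c₀ := c₁) (t : ℂ) R S P u f hu ((m : ℝ) : ℂ) μ
  have hNp : 0 ≤ NP + ‖((m : ℝ) : ℂ)‖ * Nu := by positivity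
  refine norm_covDeriv_le_weighted_of_letters_penalty φ t m a hm x₀ gf hAdf ht ha hlam hn R S hSR hRc hSc
    ((WL2.equiv ℂ (fun _ : TSite d N => c₁) V).symm fun y => WL2.equiv ℂ (fun _ : Bond d N => c₁) V u (y, μ))
    ((WL2.equiv ℂ (fun _ : TSite d N => c₁) V).symm fun y => WL2.equiv ℂ (fun _ : Bond d N => c₁) V f (y, μ))
    ((WL2.equiv ℂ (fun _ : TSite d N => c₁) V).symm fun y =>
      WL2.equiv ℂ (fun _ : Bond d N => c₁) V (P u) (y, μ) - ((m : ℝ) : ℂ) • WL2.equiv ℂ (fun _ : Bond d N => c₁) V u (y, μ))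
    hs hΓ hNp hNu (fun y => ?_) (fun y => ?_) (fun y => ?_) χ hχ1 hχp hχt hcr hcr2 h1p h1m h2 Ω hΩ hδ0 hb hb' hδ hBp hBm hBt hD hβ hβB hθ bnd
  · rw [Equiv.apply_symm_apply]; exact hf (y, μ)
  · rw [Equiv.apply_symm_apply]
    exact norm_slice_data_le (fun y => WL2.equiv ℂ (fun _ : Bond d N => c₁) V (P u) (y, μ))
      (fun y => WL2.equiv ℂ (fun _ : Bond d N => c₁) V u (y, μ)) WT ((m : ℝ) : ℂ) (fun y => hPu (y, μ)) (fun y => hval (y, μ)) y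
  · rw [Equiv.apply_symm_apply]; exact hval (y, μ)

include hAdf hm in
/-- **THE DIVERGENCE ROW OF THE LOCAL PART's SOLUTION** (plan v11 §2 (ii): the row of `D*_UA₀⁻¹`, bonds → sites, modulo the displayed weighted rows): in the setting
of `norm_covDerivL2K_slice_le_weighted`, for every site `y`: `‖(D*_U u)(y)‖ ≤ (Σ_μ ρ·B_μ)·W_{x₀}(y)` — `B9Eq38CovDivSliceGradient.norm_equiv_covDivL2K_le_weighted_of_slice_rows`
on the `d` slice rows; the bonds into `y` end at `y`, so no weight ratio enters. [folklore]
[cite: Balaban1985BackgroundPropagators, (3.8) p.392, (3.26) p.395, Thm 3.1 (3.42) p.397] -/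
theorem norm_covDivL2K_le_weighted (ht : 0 < t) (ha : 0 ≤ a) (hlam : 2 * (d : ℝ) * t ^ 2 * (Real.cosh a - 1) < m)
    (hn : ∀ ν, 2 ≤ N ν) (R S : Bond d N → V →ₗ[ℂ] V) (hSR : ∀ b w, S b (R b w) = w) (hRc : ∀ b w, ‖R b w‖ ≤ ‖w‖) (hSc : ∀ b w, ‖S b w‖ ≤ ‖w‖)
    (P : BondL2K ℂ d N c₁ V →ₗ[ℂ] BondL2K ℂ d N c₁ V) (u f : BondL2K ℂ d N c₁ V) (hu : bondLapK ℂ c₁ (t : ℂ) R S u + P u = f)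
    {Γ NP Nu : ℝ} (hΓ : 0 ≤ Γ) (hNP : 0 ≤ NP) (hNu : 0 ≤ Nu) (hf : ∀ b : Bond d N, ‖WL2.equiv ℂ _ V f b‖ ≤ Γ * WT b.1)
    (hPu : ∀ b : Bond d N, ‖WL2.equiv ℂ _ V (P u) b‖ ≤ NP * WT b.1) (hval : ∀ b : Bond d N, ‖WL2.equiv ℂ _ V u b‖ ≤ Nu * WT b.1)
    (χ : Bond d N → TSite d N → ℝ) (hχ1 : ∀ b₀ y, |χ b₀ y| ≤ 1) (hχp : ∀ b₀, χ b₀ (bpos b₀) = 1) (hχt : ∀ b₀, χ b₀ (btgt b₀) = 1)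
    {c r : ℝ} (hcr : 0 ≤ c / r) (hcr2 : 0 ≤ c / r ^ 2) (h1p : ∀ b₀ x μ, |t * (χ b₀ (shift μ x) - χ b₀ x)| ≤ c / r)
    (h1m : ∀ b₀ x μ, |t * (χ b₀ x - χ b₀ (unshift μ x))| ≤ c / r) (h2 : ∀ b₀ x μ, |t ^ 2 * (2 * χ b₀ x - χ b₀ (shift μ x) - χ b₀ (unshift μ x))| ≤ c / r ^ 2)
    (Ω : Bond d N → Set (TSite d N)) (hΩ : ∀ b₀ x, x ∉ Ω b₀ → χ b₀ x = 0 ∧ (∀ μ, χ b₀ (shift μ x) = 0) ∧ (∀ μ, χ b₀ (unshift μ x) = 0))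
    {δ b b' : ℝ} (hδ0 : 0 ≤ δ) (hb : 0 ≤ b) (hb' : 0 ≤ b') (hδ : ∀ b₀ w, ‖R b₀ w - RP[b₀] b₀ w‖ ≤ δ * ‖w‖)
    (hBp : ∀ b₀, ∀ x ∈ Ω b₀, ∀ μ w, ‖RP[b₀] (x, μ) (S (x, μ) w) - w‖ ≤ b * ‖w‖)
    (hBm : ∀ b₀, ∀ x ∈ Ω b₀, ∀ μ w, ‖RP[b₀] (unshift μ x, μ) (S (unshift μ x, μ) w) - w‖ ≤ b * ‖w‖)
    (hBt : ∀ b₀, ∀ x ∈ Ω b₀, ∀ μ w, ‖SP[b₀] (unshift μ x, μ) w - S (unshift μ x, μ) w‖ ≤ b * ‖w‖)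
    (hD : ∀ b₀, ∀ x ∈ Ω b₀, ∀ μ w, ‖(RP[b₀] (x, μ) (S (x, μ) w) - w) -
      SP[b₀] (unshift μ x, μ) (RP[b₀] (unshift μ x, μ) (S (unshift μ x, μ) (RP[b₀] (unshift μ x, μ) w)) - RP[b₀] (unshift μ x, μ) w)‖ ≤ b' * ‖w‖)
    {β : ℝ} (hβ : 0 < β) (hβB : ∀ ν, β ≤ BC ν)
    (hθ : ‖(t : ℂ)‖ * ((c / r + |t| * b) * ((Real.exp a + 1) * ∑ ν, BC ν)) < 1) (y : TSite d N) :
    ‖WL2.equiv ℂ _ V (covDivL2K ℂ c₁ (t : ℂ) S u) y‖ ≤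
      (∑ ν : Fin d, (‖(t : ℂ)‖ * ((Γ + (NP + ‖((m : ℝ) : ℂ)‖ * Nu)) +
          ((d : ℝ) * (c / r ^ 2) + |t| * b * (c / r) * ((d : ℝ) * (1 + Real.exp a)) + (d : ℝ) * (t ^ 2 * (b' + b * b))) * Nu) + |t| * δ / β * Nu) /
        (1 - ‖(t : ℂ)‖ * ((c / r + |t| * b) * ((Real.exp a + 1) * ∑ ν, BC ν))) * BC ν) * WT y :=
  norm_equiv_covDivL2K_le_weighted_of_slice_rows (c₀ := c₁) (t : ℂ) R S hSR hSc u WT BC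
    (fun _ => (‖(t : ℂ)‖ * ((Γ + (NP + ‖((m : ℝ) : ℂ)‖ * Nu)) +
          ((d : ℝ) * (c / r ^ 2) + |t| * b * (c / r) * ((d : ℝ) * (1 + Real.exp a)) + (d : ℝ) * (t ^ 2 * (b' + b * b))) * Nu) + |t| * δ / β * Nu) /
        (1 - ‖(t : ℂ)‖ * ((c / r + |t| * b) * ((Real.exp a + 1) * ∑ ν, BC ν))))
    (fun μ bnd => norm_covDerivL2K_slice_le_weighted φ t m a hm x₀ gf hAdf ht ha hlam hn R S hSR hRc hSc P u f hu hΓ hNP hNu hf hPu hval χ hχ1 hχp hχt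
      hcr hcr2 h1p h1m h2 Ω hΩ hδ0 hb hb' hδ hBp hBm hBt hD hβ hβB hθ μ bnd) y

include hAdf hm in
/-- **THE DIVERGENCE ROW, t-FREE CLOSING** (the `_uniform` reading of `B9Eq342GradientRowAssembly` §4 at the local part): with a rate `a ≤ κ`, the per-direction
letter `|t|·B_ν ≤ C ≤ K∕√m` and ONE mass choice `2·(c∕r + |t|b)·(e^{κ} + 1)·d·K ≤ √m` the contraction binder holds with `θ ≤ 1∕2`
(`B9Eq342GradientRowNaturalPerturbation.theta_le` ∕ `theta_le_half`), and `‖(D*_U u)(y)‖ ≤ (Σ_ν 2ρ₀·B_ν)·W_{x₀}(y)`,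
`ρ₀ = |t|((Γ + (N_P + ‖m‖N_u)) + ε₂N_u) + (|t|δ∕β)N_u` — no denominator. [folklore] [cite: Balaban1985BackgroundPropagators, (3.8) p.392, (3.26) p.395, Thm 3.1 (3.42) p.397] -/
theorem norm_covDivL2K_le_weighted_uniform (ht : 0 < t) (ha : 0 ≤ a) (hlam : 2 * (d : ℝ) * t ^ 2 * (Real.cosh a - 1) < m)
    (hn : ∀ ν, 2 ≤ N ν) (R S : Bond d N → V →ₗ[ℂ] V) (hSR : ∀ b w, S b (R b w) = w) (hRc : ∀ b w, ‖R b w‖ ≤ ‖w‖) (hSc : ∀ b w, ‖S b w‖ ≤ ‖w‖)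
    (P : BondL2K ℂ d N c₁ V →ₗ[ℂ] BondL2K ℂ d N c₁ V) (u f : BondL2K ℂ d N c₁ V) (hu : bondLapK ℂ c₁ (t : ℂ) R S u + P u = f)
    {Γ NP Nu : ℝ} (hΓ : 0 ≤ Γ) (hNP : 0 ≤ NP) (hNu : 0 ≤ Nu) (hf : ∀ b : Bond d N, ‖WL2.equiv ℂ _ V f b‖ ≤ Γ * WT b.1)
    (hPu : ∀ b : Bond d N, ‖WL2.equiv ℂ _ V (P u) b‖ ≤ NP * WT b.1) (hval : ∀ b : Bond d N, ‖WL2.equiv ℂ _ V u b‖ ≤ Nu * WT b.1)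
    (χ : Bond d N → TSite d N → ℝ) (hχ1 : ∀ b₀ y, |χ b₀ y| ≤ 1) (hχp : ∀ b₀, χ b₀ (bpos b₀) = 1) (hχt : ∀ b₀, χ b₀ (btgt b₀) = 1)
    {c r : ℝ} (hcr : 0 ≤ c / r) (hcr2 : 0 ≤ c / r ^ 2) (h1p : ∀ b₀ x μ, |t * (χ b₀ (shift μ x) - χ b₀ x)| ≤ c / r)
    (h1m : ∀ b₀ x μ, |t * (χ b₀ x - χ b₀ (unshift μ x))| ≤ c / r) (h2 : ∀ b₀ x μ, |t ^ 2 * (2 * χ b₀ x - χ b₀ (shift μ x) - χ b₀ (unshift μ x))| ≤ c / r ^ 2)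
    (Ω : Bond d N → Set (TSite d N)) (hΩ : ∀ b₀ x, x ∉ Ω b₀ → χ b₀ x = 0 ∧ (∀ μ, χ b₀ (shift μ x) = 0) ∧ (∀ μ, χ b₀ (unshift μ x) = 0))
    {δ b b' : ℝ} (hδ0 : 0 ≤ δ) (hb : 0 ≤ b) (hb' : 0 ≤ b') (hδ : ∀ b₀ w, ‖R b₀ w - RP[b₀] b₀ w‖ ≤ δ * ‖w‖)
    (hBp : ∀ b₀, ∀ x ∈ Ω b₀, ∀ μ w, ‖RP[b₀] (x, μ) (S (x, μ) w) - w‖ ≤ b * ‖w‖)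
    (hBm : ∀ b₀, ∀ x ∈ Ω b₀, ∀ μ w, ‖RP[b₀] (unshift μ x, μ) (S (unshift μ x, μ) w) - w‖ ≤ b * ‖w‖)
    (hBt : ∀ b₀, ∀ x ∈ Ω b₀, ∀ μ w, ‖SP[b₀] (unshift μ x, μ) w - S (unshift μ x, μ) w‖ ≤ b * ‖w‖)
    (hD : ∀ b₀, ∀ x ∈ Ω b₀, ∀ μ w, ‖(RP[b₀] (x, μ) (S (x, μ) w) - w) -
      SP[b₀] (unshift μ x, μ) (RP[b₀] (unshift μ x, μ) (S (unshift μ x, μ) (RP[b₀] (unshift μ x, μ) w)) - RP[b₀] (unshift μ x, μ) w)‖ ≤ b' * ‖w‖)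
    {β : ℝ} (hβ : 0 < β) (hβB : ∀ ν, β ≤ BC ν)
    {κ C K : ℝ} (haκ : a ≤ κ) (hC : 0 ≤ C) (htB : ∀ ν, ‖(t : ℂ)‖ * BC ν ≤ C) (hCK : C ≤ K / Real.sqrt m)
    (hmK : 2 * ((c / r + |t| * b) * (Real.exp κ + 1) * (d : ℝ) * K) ≤ Real.sqrt m) (y : TSite d N) :
    ‖WL2.equiv ℂ _ V (covDivL2K ℂ c₁ (t : ℂ) S u) y‖ ≤
      (∑ ν : Fin d, (2 * (‖(t : ℂ)‖ * ((Γ + (NP + ‖((m : ℝ) : ℂ)‖ * Nu)) +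
          ((d : ℝ) * (c / r ^ 2) + |t| * b * (c / r) * ((d : ℝ) * (1 + Real.exp a)) + (d : ℝ) * (t ^ 2 * (b' + b * b))) * Nu) + |t| * δ / β * Nu)) * BC ν) *
        WT y := by
  have hεn : 0 ≤ c / r + |t| * b := by positivity
  have htB' : ∀ ν, |t| * BC ν ≤ C := fun ν => by have e := htB ν; rwa [Complex.norm_real, Real.norm_eq_abs] at e
  have hγ : 0 ≤ Real.exp a + 1 := by positivity
  have hθle := theta_le BC hεn hγ (Real.exp_le_exp.mpr haκ) hC htB'
  have hpos : 0 ≤ (c / r + |t| * b) * (Real.exp κ + 1) * (d : ℝ) := by positivity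
  have hθhalf' := theta_le_half hθle hpos hm hCK hmK
  have hθhalf : ‖(t : ℂ)‖ * ((c / r + |t| * b) * ((Real.exp a + 1) * ∑ ν, BC ν)) ≤ 1 / 2 := by
    rw [Complex.norm_real, Real.norm_eq_abs]; exact hθhalf'
  have hθ : ‖(t : ℂ)‖ * ((c / r + |t| * b) * ((Real.exp a + 1) * ∑ ν, BC ν)) < 1 := hθhalf.trans_lt (by norm_num)
  have hmain := norm_covDivL2K_le_weighted φ t m a hm x₀ gf hAdf ht ha hlam hn R S hSR hRc hSc P u f hu hΓ hNP hNu hf hPu hval χ hχ1 hχp hχt hcr hcr2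
    h1p h1m h2 Ω hΩ hδ0 hb hb' hδ hBp hBm hBt hD hβ hβB hθ y
  have hBC : ∀ ν, 0 ≤ BC ν := fun ν => hβ.le.trans (hβB ν)
  have hA : 0 ≤ ‖(t : ℂ)‖ * ((Γ + (NP + ‖((m : ℝ) : ℂ)‖ * Nu)) +
      ((d : ℝ) * (c / r ^ 2) + |t| * b * (c / r) * ((d : ℝ) * (1 + Real.exp a)) + (d : ℝ) * (t ^ 2 * (b' + b * b))) * Nu) + |t| * δ / β * Nu := by
    positivity
  refine hmain.trans (mul_le_mul_of_nonneg_right (Finset.sum_le_sum fun ν _ => ?_) (weight_site_pos a x₀ y).le)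
  exact mul_le_mul_of_nonneg_right (div_one_sub_le_two_mul hA hθhalf) (hBC ν)

end Literature.MathematicalPhysics.QuantumFieldTheory.Balaban1983to89.B9Eq326LocalPartDivergenceRow

end
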